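import Summits.QuantumFields.YangMills.Theorems.UnitScaleTiltFluctuationComparisonRegPrLiftFaceBianchi
import Summits.QuantumFields.BalabanUV.T4Continuum.Spine.NE7.QLaBlockAvgLinear

/-!
# Route `UnitScaleTilt` — crux K1bR-pr `FluctuationComparisonRegPr` (stmt-QuantumFields-19201), stub `stub_oneStepSmallLift`
# (W7 line), piece (L2), layer F5c: THE PLAQUETTE CLAUSE OF THE KERNEL LIFT — `dist1(U⋆(∂p)) ≤ λ·δ(1+2δ) + C·δ²` from a ROW BOUND
# MODULO COARSE 2-BOUNDARIES of the kernel table (support file `--supports stmt-QuantumFields-19201`)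

Fleet seat `ym-ust-19201-p1` gen 2 (CARD-19201-oneStepSmallLift-L1L2 §1–§3).  Assembly of layers F3 (plaquettes of `E·W`, first order
isolated), F5a (exponential linearisation), F5b (row form), F6 (Bianchi):

* §1 the class of a fine plaquette: `succOff` (offsets of `x + e_μ`), `exbC`, the class row form `rowFormC` (`rowForm_eq_rowFormC`), the
  face-section term `(faceSec V)(∂p) − 1 = [edge]·(V(∂P) − 1) = [edge]·wlogZ V y o_p 0 + O(2δ²)`.
* §2 **`RowBound R kz lam β`** (hypothesis schema, what the certificates deliver by summation by parts from `Σ|tRow + ∂e| ≤ λ`, `Σ|e| ≤ β`):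
  for every class `(μ<ν, pp)` and every orientation/displacement-indexed matrix field `w` with `‖w‖ ≤ B_w` and `‖d₂w‖ ≤ B_d` on the cubes of
  the `(R+1)`-box, `‖[edge]·w(o_p, 0) + rowFormC pp μ ν w‖ ≤ lam·B_w + β·B_d`.
* §3 **`dist1_plaqHol_kernelLift_le`**: under `FaceSupported`, `RowMass K₁`, `RowBound lam β` and a `δ`-small `V`,
  `dist1(U⋆_V(∂p)) ≤ lam·(δ + 2δ²) + β·C_B(δ) + 4s² + 3K₁·unifB + 2δ² + ρ + (4t + 2ρ)δ` with `s = 2K₁δ`, `t = 2s`, `ρ = 6t²+4t³+t⁴`,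
  `C_B(δ) = 72δ² + 3·2((ℓ²/4)δ)(2δ)` — i.e. `λδ + O(δ²)`, the plaquette clause of `ApproxLift.ApproxLiftStep` with gain `λ + O(δ₀)`.

Elementary; nothing of Bałaban's is asserted.
-/

noncomputable section

open scoped BigOperators Matrix.Norms.L2Operator
open NormedSpace

namespace Summit.QuantumFields.YangMills.Theorems.ApproxLift

open Literature.MathematicalPhysics.QuantumFieldTheory.Balaban1983to89
open T4Continuum BlockAveraging AveragingRT B10Eq47AxialChi BlockAveragingSection BlockAveragingSectionPlaq ExpMeanLog MatrixLog

variable {P : Params} {j : ℕ} {n : Type*} [Fintype n] [DecidableEq n] [Nonempty n]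

/-! ## §1 The class of a fine plaquette -/

/-- The offsets of `x + e_μ`: the `μ`-th offset advanced cyclically. -/
def succOff (pp : Fin P.d → Fin P.L) (μ : Fin P.d) : Fin P.d → Fin P.L :=
  Function.update pp μ ⟨((pp μ : ℕ) + 1) % P.L, Nat.mod_lt _ P.L_pos⟩

/-- `offs (x + e_μ) = succOff (offs x) μ` (standing range). -/
theorem offs_shift (hj : j + 1 ≤ P.m + P.K) (x : Site P j) (μ : Fin P.d) : offs (x.shift μ) = succOff (offs x) μ := by
  funext i
  unfold succOff offs
  by_cases h : i = μ
  · subst h; rw [Function.update_self]; apply Fin.ext; exact offset_shift_self hj x i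
  · rw [Function.update_of_ne h]; apply Fin.ext; exact offset_shift_ne x h

/-- The exit indicator of a class in direction `a`. -/
def exbC (pp : Fin P.d → Fin P.L) (a : Fin P.d) : Bool := decide ((pp a : ℕ) = P.L - 1)

/-- `exb x a = exbC (offs x) a`. -/
theorem exb_eq_exbC (x : Site P j) (a : Fin P.d) : exb x a = exbC (offs x) a := rfl

/-- **THE CLASS ROW FORM**: `rowForm` with the site replaced by its offsets. -/
def rowFormC (R : ℕ) (kz : Fin P.d → (Fin P.d → Fin P.L) → Orient P.d → (Fin P.d → Fin (2 * R + 1)) → ℝ)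
    (pp : Fin P.d → Fin P.L) (μ ν : Fin P.d) (w : Orient P.d → (Fin P.d → ℤ) → Matrix n n ℂ) : Matrix n n ℂ :=
  (∑ o : Orient P.d, ∑ k : Fin P.d → Fin (2 * R + 1), ((kz μ pp o k : ℝ) : ℂ) • w o (kvec R k)) +
  (∑ o : Orient P.d, ∑ k : Fin P.d → Fin (2 * R + 1), ((kz ν (succOff pp μ) o k : ℝ) : ℂ) • w o (bvec (exbC pp μ) μ + kvec R k)) -
  (∑ o : Orient P.d, ∑ k : Fin P.d → Fin (2 * R + 1), ((kz μ (succOff pp ν) o k : ℝ) : ℂ) • w o (bvec (exbC pp ν) ν + kvec R k)) -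
  (∑ o : Orient P.d, ∑ k : Fin P.d → Fin (2 * R + 1), ((kz ν pp o k : ℝ) : ℂ) • w o (kvec R k))

omit [Fintype n] [DecidableEq n] [Nonempty n] in
/-- `rowForm x = rowFormC (offs x)` (standing range). -/
theorem rowForm_eq_rowFormC (hj : j + 1 ≤ P.m + P.K) (R : ℕ)
    (kz : Fin P.d → (Fin P.d → Fin P.L) → Orient P.d → (Fin P.d → Fin (2 * R + 1)) → ℝ) (x : Site P j) (μ ν : Fin P.d)
    (w : Orient P.d → (Fin P.d → ℤ) → Matrix n n ℂ) : rowForm R kz x μ ν w = rowFormC R kz (offs x) μ ν w := by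
  unfold rowForm rowFormC
  rw [offs_shift hj, offs_shift hj, exb_eq_exbC, exb_eq_exbC]

/-- `vadd y 0 = y`. -/
theorem vadd_zero (y : Site P (j + 1)) : vadd y 0 = y := by funext i; simp [vadd]

/-- `wlogZ V y o 0 = log V(∂(o; y))` (trivial transport). -/
theorem wlogZ_zero (V : GaugeField P (j + 1) (Matrix.specialUnitaryGroup n ℂ)) (y : Site P (j + 1)) (o : Orient P.d) :
    wlogZ V y o 0 = clog V ⟨y, o.1.1, o.1.2, o.2⟩ := by
  unfold wlogZ ctrans plaqAt
  rw [Summit.QuantumFields.BalabanUV.T4Continuum.Spine.NE7.stairWord_zero, vadd_zero]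
  show conjM (holAt V []) _ = _
  rw [holAt_nil, conjM_one]

/-- **THE FACE-SECTION TERM TO SECOND ORDER**: `(faceSec V)(∂p) − 1` is `wlogZ V y o_p 0` on an edge plaquette and `0` otherwise, up to
`2δ²` (`y = blockOf x`, `δ`-small `V`, `δ ≤ 1/2`, standing range). -/
theorem norm_plaqHol_faceSec_sub_one_sub_le (hj : j + 1 ≤ P.m + P.K) {δ : ℝ} {V : GaugeField P (j + 1) (Matrix.specialUnitaryGroup n ℂ)}
    (hV : PlaqSmall δ V) (hδ : δ ≤ 1 / 2) (p : Plaq P j) :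
    ‖(((GaugeField.plaqHol (faceSec V) p : Matrix.specialUnitaryGroup n ℂ) : Matrix n n ℂ) - 1) -
        (if exbC (offs p.src) p.μ = true ∧ exbC (offs p.src) p.ν = true then wlogZ V (blockOf p.src) ⟨(p.μ, p.ν), p.hμν⟩ 0 else 0)‖ ≤
      2 * δ ^ 2 := by
  have hδ0 : 0 ≤ δ := (GaugeGroup.dist1_nonneg _).trans (hV ⟨blockOf p.src, p.μ, p.ν, p.hμν⟩).le
  have hiff : (exbC (offs p.src) p.μ = true ∧ exbC (offs p.src) p.ν = true) ↔ (offset p.src p.μ = P.L - 1 ∧ offset p.src p.ν = P.L - 1) := by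
    rw [← exb_eq_exbC, ← exb_eq_exbC, exb_eq_true_iff, exb_eq_true_iff]
  rw [plaqHol_faceSec hj V p]
  by_cases h : offset p.src p.μ = P.L - 1 ∧ offset p.src p.ν = P.L - 1
  · rw [if_pos h, if_pos (hiff.mpr h), wlogZ_zero]
    have hQ : ‖((GaugeField.plaqHol V ⟨blockOf p.src, p.μ, p.ν, p.hμν⟩ : Matrix.specialUnitaryGroup n ℂ) : Matrix n n ℂ) - 1‖ ≤ δ :=
      (hV _).le
    unfold clog
    rw [← norm_neg, neg_sub]
    refine (Summit.QuantumFields.BalabanUV.Beta.EriceAxialGaugeWords.norm_mlog_sub_sub_one_le (hQ.trans hδ)).trans ?_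
    gcongr
  · rw [if_neg h, if_neg (fun h' => h (hiff.mp h'))]
    simp [hδ0]

/-! ## §2 The row-bound hypothesis -/

/-- **ROW BOUND MODULO COARSE 2-BOUNDARIES** (hypothesis schema on the kernel table; delivered by the certificates through summation by
parts from `Σ|tRow + ∂e| ≤ λ` and `Σ|e| ≤ β`): for every class `(μ < ν, pp)` and every orientation/displacement-indexed matrix field `w`
bounded by `B_w`, with coarse `d₂` bounded by `B_d` on the cubes of the `(R+1)`-box, the first-order plaquette functional
`[edge]·w(o_p; 0) + rowFormC pp μ ν w` is bounded by `lam·B_w + β·B_d`. -/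
def RowBound (n : Type*) [Fintype n] [DecidableEq n] (R : ℕ)
    (kz : Fin P.d → (Fin P.d → Fin P.L) → Orient P.d → (Fin P.d → Fin (2 * R + 1)) → ℝ) (lam β : ℝ) : Prop :=
  ∀ (μ ν : Fin P.d) (hμν : μ < ν) (pp : Fin P.d → Fin P.L) (w : Orient P.d → (Fin P.d → ℤ) → Matrix n n ℂ) (Bw Bd : ℝ),
    (∀ o m, ‖w o m‖ ≤ Bw) →
    (∀ (a b c : Fin P.d) (hab : a < b) (hbc : b < c) (m : Fin P.d → ℤ), (∀ i, (m i).natAbs ≤ R + 1) → ‖d2 w a b c hab hbc m‖ ≤ Bd) →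
    ‖(if exbC pp μ = true ∧ exbC pp ν = true then w ⟨(μ, ν), hμν⟩ 0 else 0) + rowFormC R kz pp μ ν w‖ ≤ lam * Bw + β * Bd

/-! ## §3 The plaquette clause -/

/-- The second-order Bianchi constant at box radius `N`: `72δ² + 3·2((ℓ²/4)δ)(2δ)`, `ℓ = d(N+1) + dN + 1`. -/
def bianchiB (P : Params) (N : ℕ) (δ : ℝ) : ℝ :=
  72 * δ ^ 2 + 3 * (2 * ((((P.d * (N + 1) + (P.d * N + 1) : ℕ) : ℝ) ^ 2 / 4) * δ) * (2 * δ))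

/-- `‖log V(∂q)‖ ≤ δ + 2δ²` (sharp first order), hence `‖wlogZ‖ ≤ δ + 2δ²`. -/
theorem norm_wlogZ_le_sharp {δ : ℝ} {V : GaugeField P (j + 1) (Matrix.specialUnitaryGroup n ℂ)} (hV : PlaqSmall δ V) (hδ : δ ≤ 1 / 2)
    (y : Site P (j + 1)) (o : Orient P.d) (m : Fin P.d → ℤ) : ‖wlogZ V y o m‖ ≤ δ + 2 * δ ^ 2 := by
  have hδ0 : 0 ≤ δ := (GaugeGroup.dist1_nonneg _).trans (hV (plaqAt y m o)).le
  refine (norm_conjM_le _ _).trans ?_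
  have hQ : ‖((GaugeField.plaqHol V (plaqAt y m o) : Matrix.specialUnitaryGroup n ℂ) : Matrix n n ℂ) - 1‖ ≤ δ := (hV _).le
  have h := Summit.QuantumFields.BalabanUV.Beta.EriceAxialGaugeWords.norm_mlog_sub_sub_one_le (hQ.trans hδ)
  unfold clog
  have : mlog ((GaugeField.plaqHol V (plaqAt y m o) : Matrix.specialUnitaryGroup n ℂ) : Matrix n n ℂ) =
      (mlog ((GaugeField.plaqHol V (plaqAt y m o) : Matrix.specialUnitaryGroup n ℂ) : Matrix n n ℂ) -
        ((((GaugeField.plaqHol V (plaqAt y m o) : Matrix.specialUnitaryGroup n ℂ)) : Matrix n n ℂ) - 1)) +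
      ((((GaugeField.plaqHol V (plaqAt y m o) : Matrix.specialUnitaryGroup n ℂ)) : Matrix n n ℂ) - 1) := by abel
  rw [this]
  refine (norm_add_le _ _).trans ?_
  nlinarith [h, hQ, norm_nonneg ((((GaugeField.plaqHol V (plaqAt y m o) : Matrix.specialUnitaryGroup n ℂ)) : Matrix n n ℂ) - 1)]

/-- **THE PLAQUETTE CLAUSE OF THE KERNEL LIFT**: for a table of row mass `≤ K₁` satisfying the row bound with constants
`(lam, β)`, and a `δ`-small `V` (`0 < δ ≤ 1/3`, `N·δ < π`, `2K₁δ ≤ 1`), every fine plaquette of `U⋆_V = exp(ζ_V)·faceSec V` satisfies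
`dist1(U⋆(∂p)) ≤ lam·(δ + 2δ²) + β·bianchiB(R+1, δ) + 4s² + 3K₁·unifB + 2δ² + ρ + (4t + 2ρ)·δ`, `s = 2K₁δ`, `t = 2s`, `ρ = 6t²+4t³+t⁴`
— first order `lam·δ`, everything else `O(δ²)` (standing range). -/
theorem dist1_plaqHol_kernelLift_le (hj : j + 1 ≤ P.m + P.K) {R : ℕ}
    {kz : Fin P.d → (Fin P.d → Fin P.L) → Orient P.d → (Fin P.d → Fin (2 * R + 1)) → ℝ} {K₁ lam β δ : ℝ}
    (hK : RowMass R kz K₁) (hRB : RowBound n R kz lam β) {V : GaugeField P (j + 1) (Matrix.specialUnitaryGroup n ℂ)} (hδ0 : 0 < δ)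
    (hV : PlaqSmall δ V) (hδ : δ ≤ 1 / 3) (hπ : Fintype.card n * δ < Real.pi) (hs1 : K₁ * (2 * δ) ≤ 1) (p : Plaq P j) :
    dist1 (GaugeField.plaqHol (kernelLift R kz V) p) ≤
      lam * (δ + 2 * δ ^ 2) + β * bianchiB P (R + 1) δ + 4 * (K₁ * (2 * δ)) ^ 2 + 3 * K₁ * unifB P R δ + 2 * δ ^ 2 +
        (6 * (2 * (K₁ * (2 * δ))) ^ 2 + 4 * (2 * (K₁ * (2 * δ))) ^ 3 + (2 * (K₁ * (2 * δ))) ^ 4) +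
        (4 * (2 * (K₁ * (2 * δ))) + 2 * (6 * (2 * (K₁ * (2 * δ))) ^ 2 + 4 * (2 * (K₁ * (2 * δ))) ^ 3 + (2 * (K₁ * (2 * δ))) ^ 4)) * δ := by
  have hδ' : δ ≤ 1 / 2 := hδ.trans (by norm_num)
  set s : ℝ := K₁ * (2 * δ) with hs
  set t : ℝ := 2 * s with ht
  set W := faceSec V with hW
  set E := corrE R kz V with hE
  set y := blockOf p.src with hy
  -- sizes of the correction
  have hζ : ∀ b, ‖zeta R kz V b‖ ≤ s := norm_zeta_le hδ0.le hV hδ' hK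
  have hEt : ∀ b, dist1 (E b) ≤ t := fun b => dist1_corrE_le hV hδ hπ (hζ b) hs1
  -- F3
  have h3 := dist1_plaqHol_mulField_le_lin_add E W p (hEt _) (hEt _) (hEt _) (hEt _)
  have hWp : dist1 (GaugeField.plaqHol W p) ≤ δ := (plaqSmall_faceSec hj hδ0 hV p).le
  -- F5a + F5b + face-section term
  have h5a := norm_linCobd_sub_linZeta_le (R := R) (kz := kz) hV hδ hπ W p hζ hs1
  have h5b := norm_linZeta_sub_rowForm_le (kz := kz) hj hδ0.le hV hδ' hK p
  have hD := norm_plaqHol_faceSec_sub_one_sub_le (n := n) hj hV hδ' p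
  -- the row bound at `w = wlogZ V y`
  have hrow := hRB p.μ p.ν p.hμν (offs p.src) (wlogZ V y) (δ + 2 * δ ^ 2) (bianchiB P (R + 1) δ)
    (fun o m => norm_wlogZ_le_sharp hV hδ' y o m)
    (fun a b c hab hbc m hm => norm_d2_wlogZ_le hδ0.le hV hδ y hab hbc m (R + 1) hm)
  rw [← rowForm_eq_rowFormC hj] at hrow
  -- assemble the first-order term
  have hmain : ‖linCobd E W p + ((((GaugeField.plaqHol W p : Matrix.specialUnitaryGroup n ℂ)) : Matrix n n ℂ) - 1)‖ ≤
      lam * (δ + 2 * δ ^ 2) + β * bianchiB P (R + 1) δ + 4 * s ^ 2 + 3 * K₁ * unifB P R δ + 2 * δ ^ 2 := by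
    have hsplit : linCobd E W p + ((((GaugeField.plaqHol W p : Matrix.specialUnitaryGroup n ℂ)) : Matrix n n ℂ) - 1) =
        ((if exbC (offs p.src) p.μ = true ∧ exbC (offs p.src) p.ν = true then wlogZ V y ⟨(p.μ, p.ν), p.hμν⟩ 0 else 0) +
          rowForm R kz p.src p.μ p.ν (wlogZ V y)) +
        (linCobd E W p - linZeta R kz V W p) + (linZeta R kz V W p - rowForm R kz p.src p.μ p.ν (wlogZ V y)) +
        (((((GaugeField.plaqHol W p : Matrix.specialUnitaryGroup n ℂ)) : Matrix n n ℂ) - 1) -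
          (if exbC (offs p.src) p.μ = true ∧ exbC (offs p.src) p.ν = true then wlogZ V y ⟨(p.μ, p.ν), p.hμν⟩ 0 else 0)) := by
      abel
    rw [hsplit]
    calc _ ≤ ‖(if exbC (offs p.src) p.μ = true ∧ exbC (offs p.src) p.ν = true then wlogZ V y ⟨(p.μ, p.ν), p.hμν⟩ 0 else 0) +
            rowForm R kz p.src p.μ p.ν (wlogZ V y)‖ +
          ‖linCobd E W p - linZeta R kz V W p‖ + ‖linZeta R kz V W p - rowForm R kz p.src p.μ p.ν (wlogZ V y)‖ +
          ‖((((GaugeField.plaqHol W p : Matrix.specialUnitaryGroup n ℂ)) : Matrix n n ℂ) - 1) -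
            (if exbC (offs p.src) p.μ = true ∧ exbC (offs p.src) p.ν = true then wlogZ V y ⟨(p.μ, p.ν), p.hμν⟩ 0 else 0)‖ :=
          (norm_add_le _ _).trans (add_le_add ((norm_add_le _ _).trans (add_le_add (norm_add_le _ _) le_rfl)) le_rfl)
      _ ≤ (lam * (δ + 2 * δ ^ 2) + β * bianchiB P (R + 1) δ) + 4 * s ^ 2 + 3 * K₁ * unifB P R δ + 2 * δ ^ 2 :=
          add_le_add (add_le_add (add_le_add hrow h5a) h5b) hD
      _ = _ := by ring
  -- F3's remainder
  have ht0 : 0 ≤ t := (GaugeGroup.dist1_nonneg _).trans (hEt ⟨p.src, p.μ⟩)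
  have hρ0 : 0 ≤ 6 * t ^ 2 + 4 * t ^ 3 + t ^ 4 := by positivity
  calc dist1 (GaugeField.plaqHol (kernelLift R kz V) p) = dist1 (GaugeField.plaqHol (mulField E W) p) := rfl
    _ ≤ _ := h3
    _ ≤ (lam * (δ + 2 * δ ^ 2) + β * bianchiB P (R + 1) δ + 4 * s ^ 2 + 3 * K₁ * unifB P R δ + 2 * δ ^ 2) +
          (6 * t ^ 2 + 4 * t ^ 3 + t ^ 4) + (4 * t + 2 * (6 * t ^ 2 + 4 * t ^ 3 + t ^ 4)) * δ := by
        refine add_le_add (add_le_add hmain le_rfl) ?_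
        exact mul_le_mul_of_nonneg_left hWp (by positivity)
    _ = _ := by rw [ht, hs]

end Summit.QuantumFields.YangMills.Theorems.ApproxLift

end
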